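import Summits.QuantumFields.YangMills.Theorems.SwapVirialDeficitZeroModeGroupThreeDominator
import Summits.QuantumFields.YangMills.Theorems.SwapVirialDeficitZeroModeGroupThreeSmallBallLimit
import Literature.MathematicalPhysics.QuantumLattice.SU2HaarSmallBall
import HarnessLib

/-!
# Exact zero-mode rung on the GROUP, three letters — V-c: the hub weight, joint measurability, and `∫ G dcone⊗vol⊗vol < ∞`
# (rung Z4 in Laplace form; free-hands support of ⟨stmt-QuantumFields-24197⟩, LINE «sharp-sigma»)

* §1 the hub weight `(‖Im a‖²)^{−4/3}` is integrable on the unit ball of `ℍ` / against `cone` (weighted AM–GM ✓`hub_bound` ⇒ a product of three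
  `I(4/9)`'s in the coordinates ✓`measurePreserving_coord4`), hence ★ `lintegral_cone_domBound_ne_top`: the hub integral of the dominator bound
  `4(π²/48)(‖Im a‖²)^{−4/3}I(1/3)²` of ✓`lintegral_dominator_le` is finite;
* §2 joint measurability of the rescaled integrand `h_s` (✓`hsc`) and of the dominator with the hub's own `r = ‖Im a‖`; Tonelli forms;
* §3 ★★ `lintegral_cone_prod_dominator_ne_top : ∫ G_{‖Im a‖}(x,y) d(cone ⊗ (vol ⊗ vol))(a,x,y) < ∞` — the finiteness input of BOTH dominated-convergence
  layers: the Laplace form (part V-d) and fcl-p3 g44's small-ball form ✓`…ZeroModeGroupThreeSmallBallLimit` (his hypothesis `hV`, hub first) — whence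
  ★★★ `exists_smallBall_three_limit_unconditional`: fcl-p3 g44's `Haar³{N₃(t)}/t⁴ → v₃′ > 0` with `hV` DISCHARGED (LEAD g93's small-ball shape, limit form).
HONEST LABEL: finite-dimensional real analysis (plan-level zero-mode rung); NOT the fixed-`L` sharp law, NOT ⟨24197⟩; the Yang–Mills mass gap is NOT
proved; no summit is proved by a line.  Width seat ym-line-sfw-p2-w2 g55 (cell ym-idea-1, free hands; own crux ⟨22884⟩ blocked-on ⟨19935⟩),
`--supports stmt-QuantumFields-24197`.  Standard axioms, 0 `sorry`; the three local instances of the ToronLog files.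
References: [cite: GonzalezarroyoAltes1988]; [cite: Vanbaal2001]; [folklore].
-/

set_option autoImplicit false

noncomputable section

open MeasureTheory Quaternion Set Filter Topology
open scoped Quaternion ENNReal
open Literature.MathematicalPhysics.QuantumLattice
open Literature.MathematicalPhysics.QuantumFieldTheory (haarProbability)
open Summit.QuantumFields.YangMills.Theorems.SwapTwistDeficit.ToronLog

attribute [local instance] Literature.Analysis.FluidPDE.Tao2016.quatMeasurableSpace
  Literature.Analysis.FluidPDE.Tao2016.quatBorelSpace
  Literature.MathematicalPhysics.QuantumLattice.secondCountableTopology_su2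

namespace Summit.QuantumFields.YangMills.Theorems.SwapVirialDeficit.ZeroModeGroup

/-! ## §1 The hub weight is integrable on the unit ball -/

/-- ★ The hub weight `(‖Im a‖²)^{−4/3}` is integrable on the unit ball of `ℍ` (AM–GM ⇒ a product of three `I(4/9)`'s). [folklore] -/
theorem lintegral_ball_hub_lt_top :
    ∫⁻ a : ℍ, (Metric.ball (0:ℍ) 1).indicator (fun a => ENNReal.ofReal ((‖a.im‖ ^ 2) ^ (-(4/3 : ℝ)))) a < ∞ := by
  set B : Set (ℝ × (ℝ × (ℝ × ℝ))) := {p | p.1 ^ 2 + p.2.1 ^ 2 + p.2.2.1 ^ 2 + p.2.2.2 ^ 2 < 1} with hB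
  set f : ℝ × (ℝ × (ℝ × ℝ)) → ℝ≥0∞ := fun p => B.indicator
      (fun p => ENNReal.ofReal ((p.2.1 ^ 2 + p.2.2.1 ^ 2 + p.2.2.2 ^ 2) ^ (-(4/3 : ℝ)))) p with hf
  have hBm : MeasurableSet B := measurableSet_lt (by fun_prop) measurable_const
  have hfm : Measurable f :=
    (ENNReal.measurable_ofReal.comp ((by fun_prop : Measurable fun p : ℝ × (ℝ × (ℝ × ℝ)) =>
      p.2.1 ^ 2 + p.2.2.1 ^ 2 + p.2.2.2 ^ 2).pow_const _)).indicator hBm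
  have he : ∀ a : ℍ, (Metric.ball (0:ℍ) 1).indicator (fun a => ENNReal.ofReal ((‖a.im‖ ^ 2) ^ (-(4/3 : ℝ)))) a = f (coord4 a) := by
    intro a
    have hmem : a ∈ Metric.ball (0:ℍ) 1 ↔ coord4 a ∈ B := by
      show a ∈ Metric.ball (0:ℍ) 1 ↔ a.re ^ 2 + a.imI ^ 2 + a.imJ ^ 2 + a.imK ^ 2 < 1
      rw [Metric.mem_ball, dist_zero_right, ← sq_norm_eq_sum_sq, pow_lt_one_iff_of_nonneg (norm_nonneg _) two_ne_zero]
    simp only [hf]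
    by_cases hm : a ∈ Metric.ball (0:ℍ) 1
    · have him : ‖a.im‖ ^ 2 = a.imI ^ 2 + a.imJ ^ 2 + a.imK ^ 2 := by rw [sq_norm_eq_sum_sq]; simp
      rw [indicator_of_mem hm, indicator_of_mem (hmem.1 hm), him]; rfl
    · rw [indicator_of_notMem hm, indicator_of_notMem (fun h => hm (hmem.2 h))]
  rw [lintegral_congr he, measurePreserving_coord4.lintegral_comp hfm]
  have hC : ENNReal.ofReal ((3:ℝ) ^ (-(4/3 : ℝ))) ≠ 0 := (ENNReal.ofReal_pos.2 (Real.rpow_pos_of_pos (by norm_num) _)).ne'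
  have hbd : ∀ p, f p ≤ ENNReal.ofReal ((3:ℝ) ^ (-(4/3 : ℝ))) * ({u : ℝ | u ^ 2 < 1}.indicator (fun _ => (1:ℝ≥0∞)) p.1 *
      ({u : ℝ | u ^ 2 < 1}.indicator (singPow (4/9)) p.2.1 * ({u : ℝ | u ^ 2 < 1}.indicator (singPow (4/9)) p.2.2.1 *
        {u : ℝ | u ^ 2 < 1}.indicator (singPow (4/9)) p.2.2.2))) := by
    intro p
    by_cases hm : p ∈ B
    swap
    · simp only [hf]; rw [indicator_of_notMem hm]; exact bot_le
    have hm' : p.1 ^ 2 + p.2.1 ^ 2 + p.2.2.1 ^ 2 + p.2.2.2 ^ 2 < 1 := hm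
    have h0 : p.1 ∈ {u : ℝ | u ^ 2 < 1} := by
      show p.1 ^ 2 < 1; nlinarith [sq_nonneg p.2.1, sq_nonneg p.2.2.1, sq_nonneg p.2.2.2]
    have h1 : p.2.1 ∈ {u : ℝ | u ^ 2 < 1} := by
      show p.2.1 ^ 2 < 1; nlinarith [sq_nonneg p.1, sq_nonneg p.2.2.1, sq_nonneg p.2.2.2]
    have h2 : p.2.2.1 ∈ {u : ℝ | u ^ 2 < 1} := by
      show p.2.2.1 ^ 2 < 1; nlinarith [sq_nonneg p.1, sq_nonneg p.2.1, sq_nonneg p.2.2.2]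
    have h3 : p.2.2.2 ∈ {u : ℝ | u ^ 2 < 1} := by
      show p.2.2.2 ^ 2 < 1; nlinarith [sq_nonneg p.1, sq_nonneg p.2.1, sq_nonneg p.2.2.1]
    simp only [hf]
    rw [indicator_of_mem hm, indicator_of_mem h0, indicator_of_mem h1, indicator_of_mem h2, indicator_of_mem h3, one_mul]
    by_cases z1 : p.2.1 = 0
    · rw [z1, singPow_zero, ENNReal.top_mul (mul_ne_zero (singPow_ne_zero _ _) (singPow_ne_zero _ _)), ENNReal.mul_top hC]
      exact le_top
    by_cases z2 : p.2.2.1 = 0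
    · rw [z2, singPow_zero, ENNReal.top_mul (singPow_ne_zero _ _), ENNReal.mul_top (singPow_ne_zero _ _), ENNReal.mul_top hC]
      exact le_top
    by_cases z3 : p.2.2.2 = 0
    · rw [z3, singPow_zero, ENNReal.mul_top (singPow_ne_zero _ _), ENNReal.mul_top (singPow_ne_zero _ _), ENNReal.mul_top hC]
      exact le_top
    rw [singPow_of_ne z1, singPow_of_ne z2, singPow_of_ne z3, ← ENNReal.ofReal_mul (Real.rpow_nonneg (sq_nonneg _) _),
      ← ENNReal.ofReal_mul (Real.rpow_nonneg (sq_nonneg _) _), ← ENNReal.ofReal_mul (Real.rpow_nonneg (by norm_num) _)]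
    refine ENNReal.ofReal_le_ofReal ?_
    have := hub_bound z1 z2 z3
    simpa only [mul_assoc] using this
  have hm3 : Measurable fun v : ℝ × ℝ => {u : ℝ | u ^ 2 < 1}.indicator (singPow (4/9)) v.1 * {u : ℝ | u ^ 2 < 1}.indicator (singPow (4/9)) v.2 :=
    ((measurable_boxSing _).comp measurable_fst).mul ((measurable_boxSing _).comp measurable_snd)
  have hm2 : Measurable fun u : ℝ × (ℝ × ℝ) => {u : ℝ | u ^ 2 < 1}.indicator (singPow (4/9)) u.1 *
      ({u : ℝ | u ^ 2 < 1}.indicator (singPow (4/9)) u.2.1 * {u : ℝ | u ^ 2 < 1}.indicator (singPow (4/9)) u.2.2) :=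
    ((measurable_boxSing _).comp measurable_fst).mul (hm3.comp measurable_snd)
  have hm1 : Measurable fun p : ℝ × (ℝ × (ℝ × ℝ)) => {u : ℝ | u ^ 2 < 1}.indicator (fun _ => (1:ℝ≥0∞)) p.1 *
      ({u : ℝ | u ^ 2 < 1}.indicator (singPow (4/9)) p.2.1 * ({u : ℝ | u ^ 2 < 1}.indicator (singPow (4/9)) p.2.2.1 *
        {u : ℝ | u ^ 2 < 1}.indicator (singPow (4/9)) p.2.2.2)) :=
    ((measurable_const.indicator measurableSet_sqLine).comp measurable_fst).mul (hm2.comp measurable_snd)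
  have hI := Ising_lt_top (c := 4/9) (by norm_num) (by norm_num)
  have h1 : ∫⁻ u, {u : ℝ | u ^ 2 < 1}.indicator (fun _ => (1:ℝ≥0∞)) u < ∞ := by
    rw [lintegral_indicator measurableSet_sqLine, setLIntegral_const, one_mul, volume_sqBox_one]; simp
  calc ∫⁻ p, f p ≤ ∫⁻ p : ℝ × (ℝ × (ℝ × ℝ)), ENNReal.ofReal ((3:ℝ) ^ (-(4/3 : ℝ))) * ({u : ℝ | u ^ 2 < 1}.indicator (fun _ => (1:ℝ≥0∞)) p.1 *
      ({u : ℝ | u ^ 2 < 1}.indicator (singPow (4/9)) p.2.1 * ({u : ℝ | u ^ 2 < 1}.indicator (singPow (4/9)) p.2.2.1 *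
        {u : ℝ | u ^ 2 < 1}.indicator (singPow (4/9)) p.2.2.2))) := lintegral_mono hbd
    _ = ENNReal.ofReal ((3:ℝ) ^ (-(4/3 : ℝ))) * ((∫⁻ u, {u : ℝ | u ^ 2 < 1}.indicator (fun _ => (1:ℝ≥0∞)) u) *
          (Ising (4/9) * (Ising (4/9) * Ising (4/9)))) := by
        rw [lintegral_const_mul _ hm1, lintegral_volume_prod_mul (measurable_const.indicator measurableSet_sqLine) hm2,
          lintegral_volume_prod_mul (measurable_boxSing _) hm3, lintegral_volume_prod_mul (measurable_boxSing _) (measurable_boxSing _)]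
        rfl
    _ < ∞ := ENNReal.mul_lt_top ENNReal.ofReal_lt_top (ENNReal.mul_lt_top h1 (ENNReal.mul_lt_top hI (ENNReal.mul_lt_top hI hI)))

/-- ★ The hub weight is `coneMeasure`-integrable: `∫ (‖Im a‖²)^{−4/3} dcone(a) < ∞`. [folklore] -/
theorem lintegral_cone_hub_lt_top :
    ∫⁻ a, ENNReal.ofReal ((‖a.im‖ ^ 2) ^ (-(4/3 : ℝ))) ∂coneMeasure < ∞ := by
  rw [lintegral_coneMeasure_eq]
  exact ENNReal.mul_lt_top ENNReal.ofReal_lt_top lintegral_ball_hub_lt_top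

/-- ★ The hub integral of the dominator bound of ✓`lintegral_dominator_le` is finite. [folklore] -/
theorem lintegral_cone_domBound_ne_top :
    ∫⁻ a, 4 * (ENNReal.ofReal (Real.pi ^ 2 / 48 * (‖a.im‖ ^ 2) ^ (-(4/3 : ℝ))) * (Ising (1/3) * Ising (1/3))) ∂coneMeasure ≠ ∞ := by
  have hmW : Measurable fun a : ℍ => ENNReal.ofReal ((‖a.im‖ ^ 2) ^ (-(4/3 : ℝ))) :=
    ENNReal.measurable_ofReal.comp (((Quaternion.continuous_im.norm).pow 2).measurable.pow_const _)
  have hI := Ising_lt_top (c := 1/3) (by norm_num) (by norm_num)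
  have hbeq : ∀ a : ℍ, 4 * (ENNReal.ofReal (Real.pi ^ 2 / 48 * (‖a.im‖ ^ 2) ^ (-(4/3 : ℝ))) * (Ising (1/3) * Ising (1/3))) =
      (4 * ENNReal.ofReal (Real.pi ^ 2 / 48) * (Ising (1/3) * Ising (1/3))) * ENNReal.ofReal ((‖a.im‖ ^ 2) ^ (-(4/3 : ℝ))) := by
    intro a; rw [ENNReal.ofReal_mul (by positivity)]; ring
  rw [lintegral_congr hbeq, lintegral_const_mul _ hmW]
  exact ENNReal.mul_ne_top (ENNReal.mul_ne_top (ENNReal.mul_ne_top (by norm_num) ENNReal.ofReal_ne_top) (ENNReal.mul_ne_top hI.ne hI.ne))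
    lintegral_cone_hub_lt_top.ne

/-- For `cone`-almost every hub, `a_J ≠ 0` (so `Im a ≠ 0`, `a ≠ 0`). [folklore] -/
theorem ae_cone_imJ_ne_zero : ∀ᵐ a ∂coneMeasure, a.imJ ≠ 0 := by
  have h : ∀ᵐ a ∂(volume : Measure ℍ), a.imJ ≠ 0 := by
    rw [ae_iff]; simpa only [ne_eq, not_not] using volume_imJ_eq_zero
  unfold coneMeasure; exact Measure.ae_smul_measure (ae_restrict_of_ae h) _

/-- `a_J ≠ 0 ⇒ ‖Im a‖ > 0`. [folklore] -/
theorem norm_im_pos_of_imJ_ne_zero {a : ℍ} (hJ : a.imJ ≠ 0) : 0 < ‖a.im‖ :=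
  norm_pos_iff.2 fun h => hJ (by have := congrArg (fun q : ℍ => q.imJ) h; simpa using this)

/-! ## §2 Joint measurability of `h_s` and of the hub dominator; Tonelli forms -/

/-- `a ↦ Im a` is measurable on `ℍ` (for `fun_prop`). [folklore] -/
@[fun_prop] theorem measurable_quat_im : Measurable fun q : ℍ => q.im := Quaternion.continuous_im.measurable

/-- `N_s` is measurable. [folklore] -/
theorem measurable_nsc (s : ℝ) : Measurable (nsc s) := by
  have e : nsc s = fun x : ℍ => x.re ^ 2 + x.imI ^ 2 + s * (x.imJ ^ 2 + x.imK ^ 2) := by funext x; rw [nsc_def]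
  rw [e]; fun_prop

/-- The rescaled integrand `h_s` is jointly measurable in `(x, y)`. [folklore] -/
theorem measurable_hsc_uncurry (s A r : ℝ) : Measurable fun z : ℍ × ℍ => hsc s A r z.1 z.2 := by
  have hN := measurable_nsc s
  have hS : MeasurableSet {x : ℍ | nsc s x < 1} := measurableSet_lt hN measurable_const
  have h1 : Measurable fun z : ℍ × ℍ => nsc s z.1 := hN.comp measurable_fst
  have h2 : Measurable fun z : ℍ × ℍ => nsc s z.2 := hN.comp measurable_snd
  have hE : Measurable fun z : ℍ × ℍ => esc s A r z.1 z.2 := by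
    have e : (fun z : ℍ × ℍ => esc s A r z.1 z.2) = fun z : ℍ × ℍ =>
        4 * ((z.1.imK * z.2.imI - z.1.imI * z.2.imK) ^ 2 + (z.1.imI * z.2.imJ - z.1.imJ * z.2.imI) ^ 2 +
          s * (z.1.imJ * z.2.imK - z.1.imK * z.2.imJ) ^ 2) / (nsc s z.1 * nsc s z.2) +
        4 * (r ^ 2 * (z.1.imJ ^ 2 + z.1.imK ^ 2)) / (nsc s z.1 * A) + 4 * (r ^ 2 * (z.2.imJ ^ 2 + z.2.imK ^ 2)) / (nsc s z.2 * A) := by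
      funext z; rw [esc_def]
    have m1 : Measurable fun z : ℍ × ℍ => 4 * ((z.1.imK * z.2.imI - z.1.imI * z.2.imK) ^ 2 +
        (z.1.imI * z.2.imJ - z.1.imJ * z.2.imI) ^ 2 + s * (z.1.imJ * z.2.imK - z.1.imK * z.2.imJ) ^ 2) := by fun_prop
    have m2 : Measurable fun z : ℍ × ℍ => 4 * (r ^ 2 * (z.1.imJ ^ 2 + z.1.imK ^ 2)) := by fun_prop
    have m3 : Measurable fun z : ℍ × ℍ => 4 * (r ^ 2 * (z.2.imJ ^ 2 + z.2.imK ^ 2)) := by fun_prop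
    rw [e]
    exact ((m1.div (h1.mul h2)).add (m2.div (h1.mul measurable_const))).add (m3.div (h2.mul measurable_const))
  have e : (fun z : ℍ × ℍ => hsc s A r z.1 z.2) = fun z => ({x : ℍ | nsc s x < 1}.indicator (fun _ => (1 : ℝ≥0∞)) z.1) *
      ({y : ℍ | nsc s y < 1}.indicator (fun _ => (1 : ℝ≥0∞)) z.2) * ENNReal.ofReal (Real.exp (-(esc s A r z.1 z.2))) := by
    funext z; rw [hsc_def]
  rw [e]
  exact (((measurable_const.indicator hS).comp measurable_fst).mul ((measurable_const.indicator hS).comp measurable_snd)).mul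
    (ENNReal.measurable_ofReal.comp (Real.measurable_exp.comp hE.neg))

/-- Iterated and product forms of `∫∫ h_s` agree (Tonelli). [folklore] -/
theorem lintegral_lintegral_hsc_eq (s A r : ℝ) :
    ∫⁻ x, ∫⁻ y, hsc s A r x y = ∫⁻ z, hsc s A r z.1 z.2 ∂((volume : Measure ℍ).prod volume) :=
  (lintegral_prod _ (measurable_hsc_uncurry s A r).aemeasurable).symm

/-! ## §3 The dominator is integrable against `cone ⊗ (vol ⊗ vol)` -/

/-- ★★ **`∫ G_{‖Im a‖}(x, y) d(cone ⊗ (vol ⊗ vol)) < ∞`** — the finiteness input of both dominated-convergence layers (Laplace form, part V-d;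
small-ball form, fcl-p3 g44).  Hub first, `q = (a, (x, y))`. [folklore] -/
theorem lintegral_cone_prod_dominator_ne_top :
    ∫⁻ q, dominator ‖q.1.im‖ q.2.1 q.2.2 ∂(coneMeasure.prod ((volume : Measure ℍ).prod (volume : Measure ℍ))) ≠ ∞ := by
  haveI := isProbabilityMeasure_coneMeasure
  rw [lintegral_prod _ measurable_dominator_triple.aemeasurable]
  refine ne_top_of_le_ne_top lintegral_cone_domBound_ne_top (lintegral_mono_ae ?_)
  filter_upwards [ae_cone_imJ_ne_zero] with a ha
  exact lintegral_dominator_le (norm_im_pos_of_imJ_ne_zero ha)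

/-- Iterated form: `∫ (∫∫ G_{‖Im a‖} dx dy) dcone(a) < ∞`. [folklore] -/
theorem lintegral_cone_lintegral_dominator_ne_top :
    ∫⁻ a, ∫⁻ z, dominator ‖a.im‖ z.1 z.2 ∂((volume : Measure ℍ).prod volume) ∂coneMeasure ≠ ∞ := by
  haveI := isProbabilityMeasure_coneMeasure
  rw [← lintegral_prod _ measurable_dominator_triple.aemeasurable]
  exact lintegral_cone_prod_dominator_ne_top

/-- fcl-p3 g44's iterated hypothesis `hV`, DISCHARGED: `∫dcone(a) ∫dx ∫dy G_{‖Im a‖}(x,y) < ∞`. [folklore] -/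
theorem smallBall_hV : ∫⁻ a, (∫⁻ x, ∫⁻ y, dominator ‖a.im‖ x y) ∂coneMeasure ≠ ∞ := by
  rw [← lintegral_dominator_prod_eq_iterated]
  exact lintegral_cone_prod_dominator_ne_top

/-- ★★★ **THE SMALL-BALL LIMIT, UNCONDITIONAL** (fcl-p3 g44's ✓`tendsto_haar_tripleBall_div_pow_four` with its `hV` discharged by §3):
`Haar³{C ∈ SU(2)³ | ‖[q₀,q₁]‖, ‖[q₀,q₂]‖, ‖[q₁,q₂]‖ ≤ t}/t⁴ → coneConst²·∫dcone(a) (vol⊗vol)(G₀(re a + ‖Im a‖·i))` as `t → 0⁺`.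
HONEST LABEL: plan-level zero-mode rung (limit form, no rate); the Yang–Mills mass gap is NOT proved. [folklore] -/
theorem tendsto_haar_tripleBall_div_pow_four_unconditional :
    Tendsto (fun t : ℝ => ((Measure.pi fun _ : Fin 3 => haarProbability (Matrix.specialUnitaryGroup (Fin 2) ℂ)) (tripleBall t)).toReal / t ^ 4)
      (𝓝[>] (0 : ℝ))
      (𝓝 (ENNReal.ofReal coneConst * (ENNReal.ofReal coneConst *
        ∫⁻ a, (∫⁻ x, ∫⁻ y, (rescaledSet 0 (axisPoint a)).indicator (1 : ℍ × ℍ → ℝ≥0∞) (x, y)) ∂coneMeasure)).toReal) :=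
  tendsto_haar_tripleBall_div_pow_four lintegral_cone_prod_dominator_ne_top

/-- ★★★ **HEADLINE, UNCONDITIONAL**: `∃ v₃′ > 0, Haar³{N₃(t)}/t⁴ → v₃′` as `t → 0⁺` — LEAD g93's small-ball shape of the exact `k = 3` zero-mode rung
(fcl-p3 g44's ✓`exists_smallBall_three_limit`, hypothesis discharged).  HONEST LABEL as above. [folklore] -/
theorem exists_smallBall_three_limit_unconditional :
    ∃ v : ℝ, 0 < v ∧ Tendsto (fun t : ℝ =>
      ((Measure.pi fun _ : Fin 3 => haarProbability (Matrix.specialUnitaryGroup (Fin 2) ℂ)) (tripleBall t)).toReal / t ^ 4) (𝓝[>] (0 : ℝ)) (𝓝 v) :=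
  exists_smallBall_three_limit smallBall_hV

end Summit.QuantumFields.YangMills.Theorems.SwapVirialDeficit.ZeroModeGroup

end
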